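import Literature.NumberTheory.EllipticCurves.YanZhu2026.GreenbergMainTheoremsAnyRootGuarded
import Literature.NumberTheory.EllipticCurves.BurungaleSkinnerTianWan2024.GreenbergLFunctionSupersingularExistsPRE
import HarnessLib

/-!
# Burungale–Skinner–Tian–Wan (arXiv:2409.01350v2, PREPRINT), Part I §6.6.3 Prop. 6.27 (i) (label
# `GRL=BDPL-II-ss`; with Prop. 6.20 `GRL=BDPL-ss` and Thm. 5.14 `pBDPL`): at a SUPERSINGULAR prime,
# the restriction of the integral two-variable Greenberg `p`-adic `L`-function `𝓛_p^Gr(g/L) ∈ Λ_{L,𝒪^ur}`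
# to the ANTICYCLOTOMIC line generates the same ideal as the BDP `p`-adic `L`-function — an explicitly
# labelled OPEN binder (claim-tagged; NEVER a fact), the supersingular twin of the tree's refereed
# `YanZhu2026.prop314_span_minus_eq_span_bdp_anyRoot_guarded` (Yan–Zhu Prop. 3.14 = CGS25 Prop. 2.4.5,
# good ORDINARY `p`), in exactly that currency

Written by the lead prover `bsd-wall-sbc-p1` (gen 6) of cell `bsd-wall` (run/shared/lean/pub/bsd-wall/)
for route `SignedBaseChange` of the BSD summit, crux stmt-BirchSwinnertonDyer-20727
`AnticyclotomicEisensteinDivisibility`, registered line `bdpline`, stub S3 `stub_minusIsBDP` ("`G⁻` IS a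
BDP `L`-function": at a good ordinary prime this is the refereed `prop314_…_guarded`; at a supersingular
prime the comparison is printed only in this preprint). Conventions of the sibling binders of this
directory (`thm617_…_supersingular_PRE`, `thm924_…_OPEN`, `props118_27_519_…_PRE`): UNREFEREED preprint ⇒
an explicitly labelled OPEN hypothesis (`def … : Prop`, `[claim: …, status: under-review]`), NEVER a
theorem, NEVER a `[cite:]`-fact, no `_holds`; nothing is asserted about any curve; nothing is booked.
ZERO new notions: ONE binder, nothing else.

## Printed statements (arXiv:2409.01350v2; store text `paper:arxiv-2409.01350` = the TeX in 3 000-char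
## pages `pNNNN`; printed numbers from the litref concordance `pub/bsd-litref/bstw24/sheets/LABELS-bstw24-v2.tsv`)

* §3.1.4–3.1.5 [p0027 L1–L30]: `L_∞` the `ℤ_p²`-extension of `L`, `Γ_L = Gal(L_∞/L) ≅ ℤ_p²`;
  `Γ_L^± ⊂ Γ_L` the rank-one summands on which `Gal(L/ℚ)` acts by `±1`, "`Γ_L^+` (resp. `Γ_L^-`) is
  mapped isomorphically onto `Γ_L^cyc` (resp. `Γ_L^ac`)"; topological generators `γ_+ ↔ γ_cyc`,
  `γ_- ↔ γ_ac`; `Λ_L^□ = ℤ_p⟦Γ_L^□⟧`. So "modulo `γ_+ − 1`" is the projection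
  `Λ_{L,𝒪^ur} ↠ Λ^{ac}_{L,𝒪^ur}` onto the ANTICYCLOTOMIC line.
* §6 preamble [p0049 L13–14]: "Throughout this section we assume the newform `g ∈ S₂(Γ₀(N))` to be
  supersingular at `p`" (§2.2.11: `p ∤ N`, `a_g(p) = 0`; §2.1.1: `p ≥ 3`); §2.5.1 (IQF): `L` imaginary
  quadratic, `p = v v̄` split with `v` determined via `ι_p`, `N_L` square-free (empty when `(N, D_L) = 1`).
* **Thm. 5.14** (label `pBDPL`, body l.4119; [p0043 L50–L73]): "Suppose (Heeg) holds. There exists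
  `𝓛_v^BDP(g/L) ∈ Λ^{ac}_{L,𝒪^ur} = 𝒪^ur⟦Γ_L^ac⟧` such that for `χ : Γ_L^ac → ℚ̄_p^×` with
  `χ(γ_ac^{h_p}) = ε(γ)^n`, `n > 0`, `n ≡ 0 mod p − 1`: `φ_{χ⁻¹}(𝓛_v^BDP(g/L)) =
  (1 − a(p)ψ_χ(ϖ_v̄)⁻¹p⁻¹ + ψ_χ(ϖ_v̄)⁻²p⁻¹)² · w_L n!(n−1)!(2π)^{2n−1}/(4D_L^n) · Ω_p^{4n} L(1,g,ψ_χ)/Ω_∞^{4n}`",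
  `ψ_χ` of infinity type `(−n, n)`; Remark 5.15: "The newform `g` is not required to be ordinary in
  [BDP1]: Theorem (pBDPL) holds in both the ordinary and supersingular cases." (Heeg) [p0043 L44–48]:
  "`ℓ ∣ N ⟹ ℓ` splits in `L`".
* §6.6.1 (item 6.24, label `two-variable-zeta-ss`, body l.5497–5575; [p0056 L45–p0057 L31]): the
  integral two-variable Greenberg `p`-adic `L`-function `𝓛_p^Gr(g/L) ∈ Λ_{L,𝒪_λ^ur}` at a
  supersingular prime (the object of the sibling binder `thm617_…_supersingular_PRE`, characterised on
  the type-II range by the Explicit Reciprocity Law II′, Thm. 6.17).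
* **Prop. 6.20** (label `GRL=BDPL-ss`, body l.5373; [p0055 L11–L25]): "Comparing Theorems (pBDPL) and
  (ERLIIint-thm-ss) yields: Suppose (Heeg) holds. The image of `𝓛_p^Gr(g/L)` [the `𝓡^ur`-avatar]
  under `φ_ac : 𝓡^ur ↠ Λ^{ac}_{L,𝒪^ur}` … equals `−T_ac²` times the image of `𝓛_v^BDP(g/L)` under the
  involution `ι_ac`."
* **Prop. 6.27 (i)** (label `GRL=BDPL-II-ss`, body l.5615; [p0057 L84–L94]): "From Propositions
  (GRL=BDPL-ss) and (GRLvan-prop-ss) and Theorem (BDPformula) we conclude: (i) Suppose (Heeg) holds.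
  The image of `𝓛_p^Gr(g/L)` modulo `γ_+ − 1` equals `−𝓛_v^BDP(g/L)`. In particular
  `φ_𝟙(𝓛_p^Gr(g/L)) = −(1 − a(p)p⁻¹ + p⁻¹)² (log_{ω_g}(y_L))²`." — the supersingular twin, word for
  word, of Prop. 5.28 (i) (label `GRL=BDPL-II`, ordinary, body l.4518; [p0047 L44–L53]).

## Transcription (E-instance `g = f_E`, `L = K`, `𝒪_λ = ℤ_p`) and what currency

EXACTLY the currency and shape of the refereed ordinary twin
`YanZhu2026.prop314_span_minus_eq_span_bdp_anyRoot_guarded` ("`𝓛_p^Gr(f/K)⁻·Λ_K^{ur,−} =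
𝓛_p^BDP(f/K)·Λ_K^{ur,−}`", CGS25 Prop. 2.4.5), with its `GreenbergSetting` (which carries `GoodOrd`)
replaced by the binder list of the sibling `thm617_…_supersingular_PRE`: `W` globally minimal, `f` its
newform at level `N = N_E` (`IsNewformOf`), `5 ≤ p` (print `p ≥ 3`, WEAKER), `p ∤ N_E`, `a_p(E) = 0`
("supersingular", §2.2.11), `K` imaginary quadratic, `#primesOver p = 2`, `p ∈ v`, `p ∈ v̄`, `v̄ ≠ v`,
`v` induced by `ι`, (h1) `IsCoprime N D_K`, PLUS (Heeg) (`SatisfiesHeegnerHypothesis N K`) and the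
(disc) clauses `D_K` odd, `≠ −3` of the ordinary twin (standing where the tree reads `𝓛_p^BDP`; WEAKER);
the `ℤ_p²`-tower `(κ₁, κ₂)` = (cyclotomic, anticyclotomic) with an adapted generator pair `(γ₁, γ₂)`
(receptacle `𝒪_{ℂ_p}⟦T₂⟧⟦T₁⟧`, OUTER `T₁` cyclotomic, INNER `T₂` anticyclotomic — so "modulo
`γ_+ − 1`" IS `UnrSeries₂.minus` (`= PowerSeries.constantCoeff`, killing `T₁`), the map of Yan–Zhu
§3.5 by which the ordinary twin reads "`𝓛 ↦ 𝓛⁻`"). CONCLUSION, for EVERY Katz frame with GENUINE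
period data (`Ω ≠ 0`, `δ² = ±D_K`, `Ω_p ∈ (ℤ_p^ur)ˣ`, `IsKatzMeasure₂ ι v v̄ ∅ κ₁ κ₂ γ₁⁻¹ γ₂⁻¹ 1 Ω δ Ω_p LK`),
EVERY `G` in the reduction-type-free Greenberg value frame over it (`IsGreenbergLFunctionAnyRoot₂ …` —
print's `𝓛_p^Gr(g/L) ∈ Λ_{L,𝒪^ur}`, read as in `thm617_…_PRE`), EVERY BDP frame `(Ω_K ≠ 0, Ω_p′, L)` at
the plain generator `γ₂` (`IsBDPLFunction ι v κ₂ γ₂ f Ω_K Ω_p′ L`, Castella's normalisation — print's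
`𝓛_v^BDP(g/L)` of Thm. 5.14, Remark 5.15) and every structure-compatible `J₀ : ℤ_p^ur → 𝒪_{ℂ_p}`:
`Ideal.span {minus G} = Ideal.span {PowerSeries.map J₀ L}` in `𝒪_{ℂ_p}⟦T⟧` — the IDEAL-level content
of "image modulo `γ_+ − 1` equals `−𝓛_v^BDP`" (the sign, the constant `w_L n!(n−1)!…` normalisations of
Thm. 5.14 vs Castella's, and `p`-adic unit period ratios are absorbed: WEAKER than print).

READING FLAGS (cell readings, NOT in print — why the binder is claim-tagged twice over), inherited
VERBATIM from the siblings: `BSTW-924-conjugate-convention` / "(L_p^Gr)_{CGS} = (c_*𝓛_p^Gr)_{BSTW}"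
(`GreenbergMainStatementOPEN.lean`: the tree's frame is relaxed at the `ι`-prime and reads the Katz
factor at `𝔭`; the binder quantifies over ALL `(ι, v, v̄)`, so the typed family is the conjugate image of
the printed one); `BSTW-2VS-frame` (`SignedTwoVariableDescentPackagePRE.lean`: print constructs ONE
pair `(𝓛_v(L), 𝓛_p^Gr(g/L))`; the binder reads the comparison over EVERY typed frame with genuine
period data, exactly as the ordinary twin `prop314_…_guarded` and `BurungaleCastellaSkinner2025.
prop422_greenbergAnyRoot_hasUnitContent_minus` do — two inhabited frames for the same field data differ
by a unit of `𝒪_{ℂ_p}⟦T₁,T₂⟧`, under which the displayed ideal equality is invariant); NEW flag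
`BSTW-627-normalisation`: `𝓛_v^BDP` of Thm. 5.14 is read through the tree's `IsBDPLFunction` (Castella
2018 Thm. 3.1 / Castella–Hsieh 2018 normalisation, as every BDP statement of the tree), the two
interpolation formulas differing by the sign, `p`-adic units and the period convention — invisible at the
level of ideals of `𝒪_{ℂ_p}⟦T⟧`.

WEAKER-OR-EQUAL to print in every binder except for the reading flags; never knowingly stronger. WHAT IS
NOT HERE: Prop. 6.27 (ii) (`ε(g/L) = +1`), the "in particular" value at `𝟙` (Heegner point formula,
Thm. 5.16 `BDPformula`), Prop. 6.20's `𝓡^ur`-avatar with its `−T_ac²` factor, the ordinary twin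
Prop. 5.28 (refereed elsewhere: Yan–Zhu Prop. 3.14 / CGS25 Prop. 2.4.5 = the tree's `prop314_…_guarded`),
the `𝒪_λ ≠ ℤ_p` generality.

CONSUMER: stub S3 `stub_minusIsBDP` of line `bdpline` on stmt-BirchSwinnertonDyer-20727 closes from
`prop314_…_guarded` (ordinary) ∧ THIS binder (supersingular) ∧ `BurungaleCastellaSkinner2025.
prop422_exists_isBDPLFunction_mu_eq_zero` (a BDP frame at every good prime), by the dichotomy
`p ∣ a_p ↔ a_p = 0` at `p ≥ 5` (`WeierstrassCurve.natCast_dvd_frobeniusTrace_iff_eq_zero`).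

## References
* [BurungaleSkinnerTianWan2024] A. Burungale, C. Skinner, Y. Tian, X. Wan, *Zeta elements for elliptic
  curves and applications*, arXiv:2409.01350v2 (PREPRINT): Prop. 6.27 (i) (GRL=BDPL-II-ss, body
  l.5615), Prop. 6.20 (GRL=BDPL-ss, l.5373), Thm. 6.17 (ERLIIint-thm-ss, l.5308), §6.6.1 (6.24,
  l.5497–5575), Thm. 5.14 (pBDPL, l.4119), Rem. 5.15, Prop. 5.28 (GRL=BDPL-II, l.4518), §3.1.4–3.1.5,
  §2.1.1, §2.2.11, §2.5.1.
* [YanZhu2024MainConjNonCM] J. Algebra 693 (2026), Prop. 3.14, §3.5 — the ordinary twin (tree).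
* [CastellaGrossiSkinner2025] Math. Ann. 393, Prop. 2.4.5 — the ordinary twin (tree).
* [Castella2018] Thm. 3.1; [CastellaHsieh2018] Def. 3.5 / Prop. 3.6 — the tree's `IsBDPLFunction`.
-/

noncomputable section

open scoped Classical

open PowerSeries NumberField IsDedekindDomain Field CongruenceSubgroup
  Literature.NumberTheory.GaloisRepresentations Literature.NumberTheory.EllipticCurves
  Literature.NumberTheory.EllipticCurves.ModularForms Literature.NumberTheory.EllipticCurves.UnrSeries₂

namespace Literature.NumberTheory.EllipticCurves.BurungaleSkinnerTianWan2024

/-- **OPEN HYPOTHESIS — UNREFEREED PREPRINT (arXiv:2409.01350v2), Prop. 6.27 (i) (label GRL=BDPL-II-ss;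
with Prop. 6.20 GRL=BDPL-ss, §6.6.1 and Thm. 5.14 pBDPL), for an elliptic curve: at a prime `p ≥ 5` of
good SUPERSINGULAR reduction (`p ∤ N_E`, `a_p(E) = 0`), for an imaginary quadratic `K` with `p = v v̄`
split (`v` induced by `ι`), `(N_E, D_K) = 1`, `D_K` odd, `≠ −3`, and the Heegner hypothesis, the
restriction of the integral two-variable Greenberg `p`-adic `L`-function to the anticyclotomic line
generates the same ideal as the BDP `p`-adic `L`-function** — "Suppose (Heeg) holds. The image of
`𝓛_p^Gr(g/L)` modulo `γ_+ − 1` equals `−𝓛_v^BDP(g/L)`" (Prop. 6.27 (i); `γ_+ ↔ γ_cyc`, §3.1.4).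
Transcribed (module docstring) in EXACTLY the currency and shape of the refereed ordinary twin
`YanZhu2026.prop314_span_minus_eq_span_bdp_anyRoot_guarded`, with the binder list of
`thm617_exists_isGreenbergLFunctionAnyRoot₂_supersingular_PRE` plus (Heeg) and (disc): for EVERY Katz
frame with genuine period data (`Ω ≠ 0`, `δ² = ±D_K`, `Ω_p ∈ (ℤ_p^ur)ˣ`), EVERY `G` in the
reduction-type-free Greenberg value frame `IsGreenbergLFunctionAnyRoot₂ ι v v̄ κ₁ κ₂ γ₁⁻¹ γ₂⁻¹ f |D_K| h_K
LK G` over it, EVERY BDP frame `IsBDPLFunction ι v κ₂ γ₂ f Ω_K Ω_p′ L` (`Ω_K ≠ 0`) at the plain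
anticyclotomic generator and every structure-compatible `J₀ : ℤ_p^ur → 𝒪_{ℂ_p}`:
`(minus G) = (J₀ L)` as ideals of `𝒪_{ℂ_p}⟦T⟧` (`minus = constantCoeff` kills the cyclotomic variable
`T₁` = "modulo `γ_+ − 1`"; sign / unit normalisations absorbed — WEAKER than print). READING FLAGS
`BSTW-924-conjugate-convention`, `BSTW-2VS-frame`, `BSTW-627-normalisation` of the module docstring.
NEVER cite this `Prop` as a theorem.
[claim: BurungaleSkinnerTianWan2024, status: under-review]
[cite: BurungaleSkinnerTianWan2024, Prop. 6.27 (i) (Part I §6.6.3, label GRL=BDPL-II-ss, TeX body l.5615; arXiv v2 TeX store p0057 L84–L94) with Prop. 6.20 (GRL=BDPL-ss, l.5373; p0055 L11–L25), §6.6.1 (6.24 two-variable-zeta-ss, l.5497–5575), Thm. 5.14 (pBDPL, l.4119; p0043 L50–L73) and Rem. 5.15, §3.1.4 (p0027 L11–L21: Γ_L^± ≅ Γ_L^{cyc/ac}, γ_± ↔ γ_{cyc/ac}) (ANNOUNCED, OPEN binder)] -/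
def prop627_span_minus_eq_span_bdp_supersingular_PRE : Prop :=
  ∀ {p : ℕ} [Fact p.Prime] (ι : PadicAlgCl p ≃+* ℂ) (W : WeierstrassCurve ℚ) [W.IsElliptic]
    [W.IsGloballyMinimal] (K : Type) [Field K] [NumberField K] (v vbar : HeightOneSpectrum (𝓞 K))
    (κ₁ κ₂ : ZpExtension K p) (γ₁ γ₂ : absoluteGaloisGroup K)
    [Fact (ZpExtension.IsTopGeneratorPair κ₁ κ₂ γ₁ γ₂)] {N : ℕ} [NeZero N] {f : CuspForm (Gamma0 N) 2}
    (_ : IsNewformOf W f) [NeZero (NumberField.discr K).natAbs],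
    -- `g = f_E` of level `N = N_E`; `p ≥ 5` of good SUPERSINGULAR reduction: `p ∤ N_E`, `a_p(E) = 0`
    (N : ℤ) = W.conductorNorm ℤ → 5 ≤ p → ¬ (p : ℤ) ∣ W.conductorNorm ℤ → W.frobeniusTrace p = 0 →
    -- `L = K` imaginary quadratic; `p = v v̄` split, `v` induced by `ι`; (h1) `(N, D_K) = 1`; (Heeg);
    -- (disc) as in the ordinary twin
    IsImaginaryQuadratic K → ((Ideal.span {(p : ℤ)}).primesOver (𝓞 K)).ncard = 2 →
    ((p : ℕ) : 𝓞 K) ∈ v.asIdeal → ((p : ℕ) : 𝓞 K) ∈ vbar.asIdeal → vbar ≠ v →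
    (∀ (w : InfinitePlace K) (k : 𝓞 K), k ∈ v.asIdeal ↔ ‖ι.symm (w.embedding (k : K))‖ < 1) →
    IsCoprime (N : ℤ) (NumberField.discr K) → SatisfiesHeegnerHypothesis N K →
    Odd (NumberField.discr K) → NumberField.discr K ≠ -3 →
    -- the `ℤ_p²`-tower: `κ₁` cyclotomic (outer variable `T₁`), `κ₂` anticyclotomic (inner `T₂`)
    κ₁.IsCyclotomic → κ₂.IsAnticyclotomic →
    -- every Katz frame with GENUINE period data, and every Greenberg frame over it
    ∀ (Ω δ : ℂ) (Ωp : (unrIntegers p)ˣ) (LK G : PowerSeries (PowerSeries (PadicComplexInt p))),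
      Ω ≠ 0 → (δ ^ 2 = (NumberField.discr K : ℂ) ∨ δ ^ 2 = -(NumberField.discr K : ℂ)) →
      IsKatzMeasure₂ ι v vbar ∅ κ₁ κ₂ γ₁⁻¹ γ₂⁻¹ 1 Ω δ ((Ωp : unrIntegers p) : ℂ_[p]) LK →
      IsGreenbergLFunctionAnyRoot₂ ι v vbar κ₁ κ₂ γ₁⁻¹ γ₂⁻¹ f (NumberField.discr K).natAbs
        (NumberField.classNumber K) LK G →
    -- every BDP frame at the plain anticyclotomic generator
    ∀ (ΩK : ℂ) (Ωp' : (unrIntegers p)ˣ) (L : UnrSeries p), ΩK ≠ 0 →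
      IsBDPLFunction ι v κ₂ γ₂ f ΩK ((Ωp' : unrIntegers p) : ℂ_[p]) L →
    ∀ (J₀ : unrIntegers p →+* PadicComplexInt p),
      (∀ x : unrIntegers p, ((J₀ x : PadicComplexInt p) : ℂ_[p]) = (x : ℂ_[p])) →
      Ideal.span {minus G} = Ideal.span {PowerSeries.map J₀ L}

end Literature.NumberTheory.EllipticCurves.BurungaleSkinnerTianWan2024

end
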